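import Mathlib
import Summits.NavierStokesRegularity.NavierStokesRegularity.Theorems.TaoLadderRungTwoFlatAheadCutFlow
import Summits.NavierStokesRegularity.NavierStokesRegularity.Theorems.TaoLadderRungTwoFlatDeepBehind
import Summits.NavierStokesRegularity.NavierStokesRegularity.Theorems.TaoLadderRungThreeGappedFrontRobustComparison
import HarnessLib

/-!
# FROM A CONDITIONAL BLOCK ENCLOSURE TO THE DEVIATION ROWS: the joint interface bootstrap, and the `hdevk` row of
  `…CaptureDevProfile` / `…EntryNearWeighted` for a zero-padded block reference
  (helper for the K_A♭ parent item stmt-NavierStokesRegularity-22987 `FlatGapCertificatesV2`, route TaoLadderRungTwoFlat;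
  cell harvest/h2-tao-ladder, p1 g25; theory-1 g54 CAPTURE-E2-70 ask A70-3 «infinite lattice: truncated flow as reference, or
  name the tail hypothesis»)

The deviation rows `hdevk : |S_{ik}(s) − Z_{ik}(s)| ≤ D_k` (all sites, `s ∈ [0, c₀]`) consumed by the capture / entry hop theorems
speak of the flow `S` on the WHOLE lattice, while a validated enclosure (theory-1's E2) runs on a finite BLOCK of shells
`[k_L, k_B]`. The shift set `S♭` is nearest-neighbour, so `S` restricted to the block solves the block system driven only by the
two interface shells `k_L − 1` and `k_B + 1`; an enclosure of the block INCLUSION with interface BOXES is therefore a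
CONDITIONAL row: «boxes on `[0, t]` ⇒ block deviation on `[0, t]`». This module closes the condition in the kernel:
* `conditionalBlock_closure` — the JOINT BOOTSTRAP per flow: the conditional block row (boxes `±4G` at `k_B + 1`, `±2ℓ_b` below
  `k_L`), the block-top hull row `|Z₁(k_B)| + D_{k_B} ≤ V_top` with the first cut's data, and below the block the initial
  smallness `|S₀| ≤ ι`, the block-bottom level `|Z(k_L)| + D_{k_L} ≤ B_L` and the closing inequality
  `ι + c₀·clock_{k_L−1}·T_α·max(2ℓ_b, B_L)² ≤ ℓ_b` give, on all of `[0, c₀]`: the block deviation, `|S| ≤ ℓ_b` below the block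
  and `|S| ≤ 2G` beyond it (the tree's uniform family bootstrap `GappedFrontRobust.bootstrap_family` over the sites below `k_L`
  and the interface site `k_B + 1`, with the flow's own a-priori bound as the Lipschitz modulus; the per-flow cut step
  `aheadCutStep_flow` of `…AheadCutFlow` above the block, the local bound `abs_quadTermOn_le_local` of `…DeepBehind` below);
* `init_below_of_captureClause` — the initial smallness below the block for capture-slot premises (`ι = η(n) + r`);
* `devProfile_of_conditionalBlock` — the class-level corollary: for every premise of hop `n`, the row
  `∀ i k, ∀ s ∈ [0, c₀], |S_{ik}(s) − Z_{ik}(s)| ≤ D_k` for the ZERO-PADDED reference (`Z = 0` off the block) with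
  `D_k ≥ ℓ_b` below and `D_k ≥ 2G` beyond — literally the `hdevk` hypothesis of `tubeStepCaptureWith_of_devProfile`,
  `tubeStepLandWith_entry_of_devProfile[W]`; the conditional row is stated ONCE over all kick-ball flows of `H(n)` on any
  horizon `s > 0` (conditional up to `min(s, c₀)`), so that the same row serves
* `devProfile_of_conditionalBlock_ball` — the deviation along the SHORT kick-ball flows (`[0, s]`, `s ≤ c₀`), the input of the
  K4 capture-type bound `apriori_capture_of_dev` (…CaptureDevProfile) once weighted.

HONEST FRAMING: bookkeeping and one continuity argument over the cell's typed frame (MODEL lattice, graded mirror table on `S♭`);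
the conditional block row is a BOOKED HYPOTHESIS (a validated enclosure is never a kernel object); nothing certified; no item
closed; nothing about the Navier–Stokes equations.
-/

noncomputable section

-- the sub-problem namespace repeats the summit name by design (D-0017)
set_option linter.dupNamespace false

namespace Summit.NavierStokesRegularity.NavierStokesRegularity.Theorems.HopTube

open Set Finset Filter Topology Literature.Analysis.FluidPDE Literature.Analysis.FluidPDE.TaoCascade MirrorPulse RenormFrame QuadPolar

section Flow

variable {ε ε₀ τ κ₂ : ℝ} {S₀ F₀ B₀ : Fin 2 → ℤ → ℝ} {S F : Fin 2 → ℤ → ℝ → ℝ}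

set_option maxHeartbeats 800000 in
/-- **THE JOINT INTERFACE BOOTSTRAP (per flow).** Along ONE exact graded-mirror pseudo-flow on `[0, τ] ⊇ [0, c₀]`: the
CONDITIONAL block row («`|S_{i,k_B+1}| ≤ 4G` and `|S_{ik}| ≤ 2ℓ_b` (`k < k_L`) on `[0, t]` ⇒ `|S − Z|_{ik} ≤ D_k` on the block
`[k_L, k_B]` on `[0, t]`», every `t ≤ c₀`), the block-top hull row `|Z₁(k_B, ·)| + D_{k_B} ≤ V_top` with the first cut's initial
tail `G` and closing inequality, and below the block `|S₀| ≤ ι`, the block-bottom level `|Z(k_L, ·)| + D_{k_L} ≤ B_L` and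
`ι + c₁·clock_{k_L−1}·T_α·max(2ℓ_b, B_L)² ≤ ℓ_b` (closings at any `c₁ ≥ c₀`) give on ALL of `[0, c₀]`: the block deviation, `|S_{ik}| ≤ ℓ_b` below the block
and `|S_{im}| ≤ 2G` beyond it. (Uniform family bootstrap over the sites below `k_L` and the interface site `k_B + 1`; the
Lipschitz modulus is the flow's own qualitative a-priori bound, which the conclusion does not see.)
[cite: Tao2016AveragedNS, §4 (4.3), Lemma 4.1 (4.5), (4.8), §5 (continuity argument) (statement shape); cell LADDER §62, §70 (CAPTURE-E2-70, A70-3)] -/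
theorem conditionalBlock_closure (hflow : PseudoFlowOnShift shiftSetFlat τ ε₀ (mirrorTable ε ε) 0 κ₂ S₀ F₀ B₀ S F)
    (hε : 0 ≤ ε) (hε₀ : 0 < ε₀) {c₀ c₁ : ℝ} (hc₀ : 0 ≤ c₀) (hc₀τ : c₀ ≤ τ) (hc₁ : c₀ ≤ c₁)
    {kL kB : ℤ} (hLB : kL ≤ kB) {Z : Fin 2 → ℤ → ℝ → ℝ} {Dk : ℤ → ℝ}
    {G ℓb Vtop BL ι : ℝ} (hG : 0 < G) (hℓb : 0 < ℓb) (hVtop : 0 ≤ Vtop) (hBL : 0 ≤ BL)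
    -- the CONDITIONAL block row (booked): interface boxes on `[0, t]` ⇒ block deviation on `[0, t]`
    (hblock : ∀ t ∈ Icc 0 c₀,
      (∀ s ∈ Icc 0 t, ∀ i : Fin 2, |S i (kB + 1) s| ≤ 4 * G ∧ ∀ k : ℤ, k < kL → |S i k s| ≤ 2 * ℓb) →
        ∀ s ∈ Icc 0 t, ∀ (i : Fin 2) (k : ℤ), kL ≤ k → k ≤ kB → |S i k s - Z i k s| ≤ Dk k)
    -- ABOVE the block: hull row at the block top, initial tail beyond it, closing inequality of the first cut
    (hVt : ∀ s ∈ Icc 0 c₀, |Z 1 kB s| + Dk kB ≤ Vtop)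
    (hinit : ∀ N : Finset ℤ, (∀ m ∈ N, kB < m) → ∑ m ∈ N, ∑ i : Fin 2, S₀ i m ^ 2 ≤ G ^ 2)
    (hcloseA : 4 / 3 * c₁ * clock ε₀ kB * Vtop * (Vtop + 2 * ε * G) < G)
    -- BELOW the block: initial smallness, block-bottom level, closing inequality
    (hι : ∀ (i : Fin 2) (k : ℤ), k < kL → |S₀ i k| ≤ ι)
    (hBLrow : ∀ s ∈ Icc 0 c₀, ∀ i : Fin 2, |Z i kL s| + Dk kL ≤ BL)
    (hcloseB : ι + c₁ * clockW ε₀ (kL - 1) * tableAbsSum shiftSetFlat (mirrorTable ε ε) * max (2 * ℓb) BL ^ 2 ≤ ℓb) :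
    ∀ s ∈ Icc 0 c₀, (∀ (i : Fin 2) (k : ℤ), kL ≤ k → k ≤ kB → |S i k s - Z i k s| ≤ Dk k) ∧
      (∀ (i : Fin 2) (k : ℤ), k < kL → |S i k s| ≤ ℓb) ∧ (∀ (i : Fin 2) (m : ℤ), kB < m → |S i m s| ≤ 2 * G) := by
  have hc₁0 : 0 ≤ c₁ := hc₀.trans hc₁
  have hsub : Icc 0 c₀ ⊆ Icc 0 τ := Icc_subset_Icc le_rfl hc₀τ
  have hT0 : 0 ≤ tableAbsSum shiftSetFlat (mirrorTable ε ε) := tableAbsSum_nonneg _ _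
  set Tα := tableAbsSum shiftSetFlat (mirrorTable ε ε) with hTα
  -- the flow's own a-priori bound (qualitative; only the Lipschitz modulus depends on it)
  obtain ⟨M, hM⟩ := hflow.apriori_S
  have hMabs : ∀ s ∈ Icc 0 τ, ∀ (i : Fin 2) (k : ℤ), |S i k s| ≤ |M| := by
    intro s hs i k
    have h := hM s hs i k
    have hx : 0 ≤ (1 + ε₀) ^ ((10 : ℝ) * k) := by positivity
    have h1 : |S i k s| ≤ (1 + (1 + ε₀) ^ ((10 : ℝ) * k)) * |S i k s| := by
      have := abs_nonneg (S i k s); nlinarith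
    exact h1.trans (h.trans (le_abs_self M))
  -- the derivative of every amplitude and its bounds
  have hder : ∀ (i : Fin 2) (k : ℤ), ∀ s ∈ Icc 0 τ,
      HasDerivWithinAt (S i k) (quadTermOn shiftSetFlat ε₀ (mirrorTable ε ε) S i k s) (Icc 0 τ) s :=
    fun i k s hs => QuadPolar.hasDerivWithinAt_Icc_of_pseudoFlowOnShift_exact hflow i k hs
  have hqM : ∀ (i : Fin 2) (k : ℤ), ∀ s ∈ Icc 0 τ,
      |quadTermOn shiftSetFlat ε₀ (mirrorTable ε ε) S i k s| ≤ clockW ε₀ k * Tα * |M| ^ 2 :=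
    fun i k s hs => abs_quadTermOn_le_local isNearestNeighbourSet_shiftSetFlat hε₀.le (mirrorTable ε ε) (abs_nonneg M)
      (fun j k' _ _ => hMabs s hs j k') i
  have hlipS : ∀ (i : Fin 2) (k : ℤ), ∀ s ∈ Icc 0 τ, ∀ t ∈ Icc 0 τ,
      |S i k t - S i k s| ≤ clockW ε₀ k * Tα * |M| ^ 2 * |t - s| := by
    intro i k s hs t ht
    have h := (convex_Icc 0 τ).norm_image_sub_le_of_norm_hasDerivWithin_le (hder i k)
      (fun x hx => by rw [Real.norm_eq_abs]; exact hqM i k x hx) hs ht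
    rwa [Real.norm_eq_abs, Real.norm_eq_abs] at h
  have hcW0 : ∀ k, 0 ≤ clockW ε₀ k := fun k => (clockW_pos (by linarith) k).le
  have hcL : 0 ≤ clockW ε₀ (kL - 1) := hcW0 _
  have hcB1 : 0 ≤ clockW ε₀ (kB + 1) := hcW0 _
  -- the Lipschitz moduli and the family
  set Lb : ℝ := clockW ε₀ (kL - 1) * Tα * |M| ^ 2 with hLb
  set La : ℝ := clockW ε₀ (kB + 1) * Tα * |M| ^ 2 with hLa
  have hLb0 : 0 ≤ Lb := by positivity
  have hLa0 : 0 ≤ La := by positivity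
  set L : ℝ := Lb / ℓb + La / (2 * G) with hL
  have hL0 : 0 ≤ L := by positivity
  have hG2 : (0 : ℝ) < 2 * G := by positivity
  have hLb' : Lb ≤ L * ℓb := by
    have e : L * ℓb = Lb + La / (2 * G) * ℓb := by rw [hL]; field_simp
    have : 0 ≤ La / (2 * G) * ℓb := by positivity
    linarith
  have hLa' : La ≤ L * (2 * G) := by
    have e : L * (2 * G) = Lb / ℓb * (2 * G) + La := by rw [hL]; field_simp
    have : 0 ≤ Lb / ℓb * (2 * G) := by positivity
    linarith
  let ι' := {q : Fin 2 × ℤ // q.2 < kL ∨ q.2 = kB + 1}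
  let u : ι' → ℝ → ℝ := fun q t => |S q.1.1 q.1.2 t|
  let p : ι' → ℝ := fun q => if q.1.2 < kL then ℓb else 2 * G
  have hp0 : ∀ q, 0 ≤ p q := fun q => by
    simp only [p]; split_ifs
    · exact hℓb.le
    · exact hG2.le
  have hιℓ : ι ≤ ℓb := by
    have : 0 ≤ c₁ * clockW ε₀ (kL - 1) * Tα * max (2 * ℓb) BL ^ 2 := by positivity
    linarith
  have h0a : ∀ i : Fin 2, |S₀ i (kB + 1)| ≤ G := by
    intro i
    have h := hinit {kB + 1} (by intro m hm; rw [Finset.mem_singleton] at hm; omega)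
    rw [Finset.sum_singleton, Fin.sum_univ_two] at h
    have hsq : S₀ i (kB + 1) ^ 2 ≤ G ^ 2 := by
      fin_cases i
      · simp only [Fin.zero_eta, Fin.isValue]; nlinarith [sq_nonneg (S₀ 1 (kB + 1))]
      · simp only [Fin.mk_one, Fin.isValue]; nlinarith [sq_nonneg (S₀ 0 (kB + 1))]
    exact abs_le.mpr (abs_le_of_sq_le_sq' hsq hG.le)
  -- (L) uniform Lipschitz
  have hlip : ∀ q : ι', ∀ s ∈ Icc 0 c₀, ∀ t ∈ Icc 0 c₀, |u q t - u q s| ≤ L * p q * |t - s| := by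
    rintro ⟨⟨i, k⟩, hk⟩ s hs t ht
    simp only [u, p]
    have htri : abs (|S i k t| - |S i k s|) ≤ |S i k t - S i k s| := abs_abs_sub_abs_le_abs_sub _ _
    have hl := hlipS i k s (hsub hs) t (hsub ht)
    have hts : 0 ≤ |t - s| := abs_nonneg _
    rcases hk with hk | hk
    · have hk1 : k < kL := hk
      rw [if_pos hk1]
      have hck : clockW ε₀ k ≤ clockW ε₀ (kL - 1) := clockW_mono hε₀.le (by omega)
      have h1 : clockW ε₀ k * Tα * |M| ^ 2 ≤ Lb := by
        rw [hLb]; exact mul_le_mul_of_nonneg_right (mul_le_mul_of_nonneg_right hck hT0) (sq_nonneg _)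
      calc abs (|S i k t| - |S i k s|) ≤ clockW ε₀ k * Tα * |M| ^ 2 * |t - s| := htri.trans hl
        _ ≤ L * ℓb * |t - s| := mul_le_mul_of_nonneg_right (h1.trans hLb') hts
    · have hk1 : k = kB + 1 := hk
      have hk2 : ¬ k < kL := by omega
      rw [if_neg hk2]
      rw [hk1] at htri hl ⊢
      calc abs (|S i (kB + 1) t| - |S i (kB + 1) s|) ≤ La * |t - s| := htri.trans hl
        _ ≤ L * (2 * G) * |t - s| := mul_le_mul_of_nonneg_right hLa' hts
  -- (0) initial values
  have h0 : ∀ q : ι', u q 0 ≤ (fun _ : ℝ => (1 : ℝ)) 0 * p q := by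
    rintro ⟨⟨i, k⟩, hk⟩
    simp only [u, p, one_mul]
    rw [hflow.init_S]
    rcases hk with hk | hk
    · have hk1 : k < kL := hk
      rw [if_pos hk1]; exact (hι i k hk1).trans hιℓ
    · have hk1 : k = kB + 1 := hk
      have hk2 : ¬ k < kL := by omega
      rw [if_neg hk2, hk1]; linarith [h0a i]
  -- (I) the improvement step
  have himp : ∀ t ∈ Icc 0 c₀, (∀ q : ι', ∀ s ∈ Icc 0 t, u q s ≤ 2 * (fun _ : ℝ => (1 : ℝ)) s * p q) →
      ∀ q : ι', u q t ≤ (fun _ : ℝ => (1 : ℝ)) t * p q := by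
    intro t ht hpast
    have htc : t ≤ c₀ := ht.2
    have htτ : t ≤ τ := htc.trans hc₀τ
    -- the fat levels on `[0, t]`, hence the block deviation on `[0, t]`
    have hfat : ∀ s ∈ Icc 0 t, ∀ i : Fin 2, |S i (kB + 1) s| ≤ 4 * G ∧ ∀ k : ℤ, k < kL → |S i k s| ≤ 2 * ℓb := by
      intro s hs i
      refine ⟨?_, fun k hk => ?_⟩
      · have h := hpast ⟨(i, kB + 1), Or.inr rfl⟩ s hs
        have hk2 : ¬ kB + 1 < kL := by omega
        simp only [u, p] at h
        rw [if_neg hk2] at h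
        linarith
      · have h := hpast ⟨(i, k), Or.inl hk⟩ s hs
        simp only [u, p] at h
        rw [if_pos hk] at h
        linarith
    have hIN := hblock t ht hfat
    rintro ⟨⟨i, k⟩, hk⟩
    simp only [u, p, one_mul]
    rcases hk with hk | hk
    · -- a site below the block: integrate the local bound of the vector field
      have hk1 : k < kL := hk
      rw [if_pos hk1]
      set N : ℝ := max (2 * ℓb) BL with hN
      have hN0 : 0 ≤ N := le_max_of_le_right hBL
      have hnb : ∀ s ∈ Icc 0 t, ∀ (j : Fin 2) (k' : ℤ), k - 1 ≤ k' → k' ≤ k + 1 → |S j k' s| ≤ N := by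
        intro s hs j k' _ h2
        rcases lt_or_ge k' kL with hk'L | hk'L
        · exact ((hfat s hs j).2 k' hk'L).trans (le_max_left _ _)
        · have hk'eq : k' = kL := by omega
          rw [hk'eq]
          have hd := hIN s hs j kL le_rfl hLB
          have hz := hBLrow s ⟨hs.1, hs.2.trans htc⟩ j
          have := abs_sub_abs_le_abs_sub (S j kL s) (Z j kL s)
          exact le_trans (by linarith) (le_max_right _ _)
      have hsubt : Icc 0 t ⊆ Icc 0 τ := Icc_subset_Icc le_rfl htτ
      have hmvt := norm_image_sub_le_of_norm_deriv_le_segment' (f := S i k) (a := 0) (b := t)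
        (C := clockW ε₀ (kL - 1) * Tα * N ^ 2)
        (fun x hx => (hder i k x (hsubt hx)).mono hsubt)
        (fun x hx => by
          rw [Real.norm_eq_abs]
          have hxI : x ∈ Icc 0 t := ⟨hx.1, hx.2.le⟩
          have hq := abs_quadTermOn_le_local isNearestNeighbourSet_shiftSetFlat hε₀.le (mirrorTable ε ε) hN0
            (fun j k' h1 h2 => hnb x hxI j k' h1 h2) i
          have hck : clockW ε₀ k ≤ clockW ε₀ (kL - 1) := clockW_mono hε₀.le (by omega)
          exact hq.trans (mul_le_mul_of_nonneg_right (mul_le_mul_of_nonneg_right hck hT0) (sq_nonneg _)))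
        t (right_mem_Icc.mpr ht.1)
      rw [Real.norm_eq_abs, sub_zero, hflow.init_S] at hmvt
      have hC0 : 0 ≤ clockW ε₀ (kL - 1) * Tα * N ^ 2 := by positivity
      have hCt : clockW ε₀ (kL - 1) * Tα * N ^ 2 * t ≤ c₁ * clockW ε₀ (kL - 1) * Tα * N ^ 2 := by
        have := mul_le_mul_of_nonneg_left (htc.trans hc₁) hC0; linarith
      have htri : |S i k t| ≤ |S₀ i k| + |S i k t - S₀ i k| := by
        have := abs_add_le (S₀ i k) (S i k t - S₀ i k); rwa [add_sub_cancel] at this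
      linarith [hι i k hk1, hmvt, hCt, hcloseB, htri]
    · -- the interface site above the block: the per-flow cut step at horizon `t`
      have hk1 : k = kB + 1 := hk
      have hk2 : ¬ k < kL := by omega
      rw [if_neg hk2, hk1]
      have hhull : ∀ s ∈ Icc 0 t, |S 1 kB s| ≤ Vtop := by
        intro s hs
        have hd := hIN s hs 1 kB hLB le_rfl
        have hz := hVt s ⟨hs.1, hs.2.trans htc⟩
        have := abs_sub_abs_le_abs_sub (S 1 kB s) (Z 1 kB s)
        linarith
      exact aheadCutStep_flow hflow hε hε₀ ht.1 htτ (htc.trans hc₁) hVtop hG.le hhull hinit hcloseA t ⟨ht.1, le_rfl⟩ i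
        (kB + 1) (by omega)
  -- THE BOOTSTRAP, and reading off the conclusion
  have key := GappedFrontRobust.bootstrap_family (u := u) (p := p) (ψ := fun _ : ℝ => (1 : ℝ)) (τ := c₀) (L := L)
    hp0 hL0 continuousOn_const (fun _ _ => one_pos) hlip h0 himp
  have hthin : ∀ s ∈ Icc 0 c₀, ∀ i : Fin 2, |S i (kB + 1) s| ≤ 2 * G ∧ ∀ k : ℤ, k < kL → |S i k s| ≤ ℓb := by
    intro s hs i
    refine ⟨?_, fun k hk => ?_⟩
    · have h := key ⟨(i, kB + 1), Or.inr rfl⟩ s hs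
      have hk2 : ¬ kB + 1 < kL := by omega
      simp only [u, p, one_mul] at h
      rw [if_neg hk2] at h
      exact h
    · have h := key ⟨(i, k), Or.inl hk⟩ s hs
      simp only [u, p, one_mul] at h
      rw [if_pos hk] at h
      exact h
  have hINall := hblock c₀ (right_mem_Icc.mpr hc₀) fun s hs i =>
    ⟨(hthin s hs i).1.trans (by linarith), fun k hk => ((hthin s hs i).2 k hk).trans (by linarith)⟩
  have hhull : ∀ s ∈ Icc 0 c₀, |S 1 kB s| ≤ Vtop := by
    intro s hs
    have hd := hINall s hs 1 kB hLB le_rfl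
    have := abs_sub_abs_le_abs_sub (S 1 kB s) (Z 1 kB s)
    linarith [hVt s hs]
  intro s hs
  exact ⟨hINall s hs, fun i k hk => (hthin s hs i).2 k hk,
    fun i m hm => aheadCutStep_flow hflow hε hε₀ hc₀ hc₀τ hc₁ hVtop hG.le hhull hinit hcloseA s hs i m hm⟩

end Flow

/-- **Initial smallness below the block for capture-slot premises**: `|S₀_{ik}| ≤ η(n) + r` for `k < k_L` when the checkpoint
state vanishes below `k_L` (`CaptureClause` sup-ball, kick ball with `w ≥ 1`). [cite: Tao2016AveragedNS, §6.3–6.4 (statement shape); cell LADDER §50 (capture slot), §70 (A70-3)] -/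
theorem init_below_of_captureClause (P : TubeSchedule) {ζ : ℕ → Fin 2 → ℤ → ℝ} {n : ℕ} {z S₀ : Fin 2 → ℤ → ℝ}
    {w : ℤ → ℝ} {r : ℝ} {kL : ℤ} (hz : CaptureClause P ζ n z) (hζ : ∀ (i : Fin 2) (k : ℤ), k < kL → ζ n i k = 0)
    (hw1 : ∀ k, 1 ≤ w k) (hkick : ∀ i k, w k * |S₀ i k - z i k| ≤ r) :
    ∀ (i : Fin 2) (k : ℤ), k < kL → |S₀ i k| ≤ P.η n + r := by
  intro i k hk
  have h1 := hz i k
  rw [hζ i k hk, sub_zero] at h1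
  have h2 : |S₀ i k - z i k| ≤ r := by
    have hwk := hw1 k
    have h3 := hkick i k
    have h0 : 0 ≤ |S₀ i k - z i k| := abs_nonneg _
    nlinarith
  have h4 := abs_add_le (S₀ i k - z i k) (z i k)
  rw [sub_add_cancel] at h4
  linarith

section Class

variable {ε ε₀ : ℝ}

/-- **THE `hdevk` ROW FROM A CONDITIONAL BLOCK ENCLOSURE (class level, hop premises).** For every premise of hop `n`: the
conditional block row — stated ONCE over all kick-ball flows of `H(n)` on any horizon `s > 0`, conditional up to `min(s, c₀)` —,
the block-top hull row with the first cut's data, the initial smallness and the block-bottom level below the block with its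
closing inequality, and a reference that VANISHES off the block with a profile `D_k ≥ ℓ_b` below and `D_k ≥ 2G` beyond, give
`|S_{ik}(s) − Z_{ik}(s)| ≤ D_k` for ALL sites and all `s ∈ [0, c₀]` — literally the `hdevk` hypothesis of
`tubeStepCaptureWith_of_devProfile` / `tubeStepLandWith_entry_of_devProfile[W]`.
[cite: Tao2016AveragedNS, §4 Lemma 4.1, §5, §6.2 Prop. 6.3 (ix) (statement shape); cell LADDER §69–§70 (CAPTURE-69, CAPTURE-E2-70, A-132, A70-3)] -/
theorem devProfile_of_conditionalBlock (P : TubeSchedule) {Bcl : ℕ → (Fin 2 → ℤ → ℝ) → Prop} {i₀ : Fin 2}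
    {X₀ : Fin 2 → ℝ} {w : ℤ → ℝ} {r c₀ : ℝ} {ζ : ℕ → Fin 2 → ℤ → ℝ} {ustar : Fin 2 → ℤ → ℝ} {n : ℕ}
    (hε : 0 ≤ ε) (hε₀ : 0 < ε₀) (hc₀ : 0 < c₀)
    {kL kB : ℤ} (hLB : kL ≤ kB) {Z : Fin 2 → ℤ → ℝ → ℝ} {Dk : ℤ → ℝ}
    {G ℓb Vtop BL ι : ℝ} (hG : 0 < G) (hℓb : 0 < ℓb) (hVtop : 0 ≤ Vtop) (hBL : 0 ≤ BL)
    (hblock : ∀ z S₀ s S F, InTubeWith P Bcl i₀ X₀ w r ζ ustar n z → (∀ i k, w k * |S₀ i k - z i k| ≤ r) → 0 < s →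
      PseudoFlowOnShift shiftSetFlat s ε₀ (mirrorTable ε ε) 0 0 S₀ (fun i k => (1 / 2) * S₀ i k ^ 2) (fun _ _ => 0) S F →
        ∀ t ∈ Icc 0 c₀, t ≤ s →
          (∀ s' ∈ Icc 0 t, ∀ i : Fin 2, |S i (kB + 1) s'| ≤ 4 * G ∧ ∀ k : ℤ, k < kL → |S i k s'| ≤ 2 * ℓb) →
            ∀ s' ∈ Icc 0 t, ∀ (i : Fin 2) (k : ℤ), kL ≤ k → k ≤ kB → |S i k s' - Z i k s'| ≤ Dk k)
    (hVt : ∀ s ∈ Icc 0 c₀, |Z 1 kB s| + Dk kB ≤ Vtop)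
    (hinit : ∀ z S₀ : Fin 2 → ℤ → ℝ, InTubeWith P Bcl i₀ X₀ w r ζ ustar n z → (∀ i k, w k * |S₀ i k - z i k| ≤ r) →
      ∀ N : Finset ℤ, (∀ m ∈ N, kB < m) → ∑ m ∈ N, ∑ i : Fin 2, S₀ i m ^ 2 ≤ G ^ 2)
    (hcloseA : 4 / 3 * c₀ * clock ε₀ kB * Vtop * (Vtop + 2 * ε * G) < G)
    (hι : ∀ z S₀ : Fin 2 → ℤ → ℝ, InTubeWith P Bcl i₀ X₀ w r ζ ustar n z → (∀ i k, w k * |S₀ i k - z i k| ≤ r) →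
      ∀ (i : Fin 2) (k : ℤ), k < kL → |S₀ i k| ≤ ι)
    (hBLrow : ∀ s ∈ Icc 0 c₀, ∀ i : Fin 2, |Z i kL s| + Dk kL ≤ BL)
    (hcloseB : ι + c₀ * clockW ε₀ (kL - 1) * tableAbsSum shiftSetFlat (mirrorTable ε ε) * max (2 * ℓb) BL ^ 2 ≤ ℓb)
    -- the reference vanishes off the block; the profile dominates the levels there
    (hZb : ∀ (i : Fin 2) (k : ℤ) (s : ℝ), k < kL → Z i k s = 0) (hZa : ∀ (i : Fin 2) (k : ℤ) (s : ℝ), kB < k → Z i k s = 0)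
    (hDb : ∀ k : ℤ, k < kL → ℓb ≤ Dk k) (hDa : ∀ k : ℤ, kB < k → 2 * G ≤ Dk k) :
    ∀ z S₀ τ S F, HopPremiseWith P Bcl shiftSetFlat ε₀ i₀ (mirrorTable ε ε) X₀ w r c₀ ζ ustar n z S₀ τ S F →
      ∀ (i : Fin 2) (k : ℤ), ∀ s ∈ Icc 0 c₀, |S i k s - Z i k s| ≤ Dk k := by
  intro z S₀ τ S F hprem i k s hs
  obtain ⟨hz, hkick, hc₀τ, hflow⟩ := hprem
  obtain ⟨hIN, hB, hA⟩ := conditionalBlock_closure hflow hε hε₀ hc₀.le hc₀τ le_rfl hLB hG hℓb hVtop hBL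
    (fun t ht => hblock z S₀ τ S F hz hkick (hc₀.trans_le hc₀τ) hflow t ht (ht.2.trans hc₀τ)) hVt (hinit z S₀ hz hkick)
    hcloseA (hι z S₀ hz hkick) hBLrow hcloseB s hs
  rcases lt_or_ge k kL with hk | hk
  · rw [hZb i k s hk, sub_zero]; exact (hB i k hk).trans (hDb k hk)
  rcases le_or_gt k kB with hk' | hk'
  · exact hIN i k hk hk'
  · rw [hZa i k s hk', sub_zero]; exact (hA i k hk').trans (hDa k hk')

/-- **THE SAME ROW ALONG THE SHORT KICK-BALL FLOWS** (`[0, s]`, `0 < s ≤ c₀`) of `H(n)` — the `hdevω`-type input of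
`apriori_capture_of_dev` (the K4 capture-type bound) once weighted —, from the same conditional block row and data.
[cite: Tao2016AveragedNS, §4 Lemma 4.1, §5 (statement shape); cell LADDER §47.5 L2 (K4), §70 (A70-3)] -/
theorem devProfile_of_conditionalBlock_ball (P : TubeSchedule) {Bcl : ℕ → (Fin 2 → ℤ → ℝ) → Prop} {i₀ : Fin 2}
    {X₀ : Fin 2 → ℝ} {w : ℤ → ℝ} {r c₀ : ℝ} {ζ : ℕ → Fin 2 → ℤ → ℝ} {ustar : Fin 2 → ℤ → ℝ} {n : ℕ}
    (hε : 0 ≤ ε) (hε₀ : 0 < ε₀)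
    {kL kB : ℤ} (hLB : kL ≤ kB) {Z : Fin 2 → ℤ → ℝ → ℝ} {Dk : ℤ → ℝ}
    {G ℓb Vtop BL ι : ℝ} (hG : 0 < G) (hℓb : 0 < ℓb) (hVtop : 0 ≤ Vtop) (hBL : 0 ≤ BL)
    (hblock : ∀ z S₀ s S F, InTubeWith P Bcl i₀ X₀ w r ζ ustar n z → (∀ i k, w k * |S₀ i k - z i k| ≤ r) → 0 < s →
      PseudoFlowOnShift shiftSetFlat s ε₀ (mirrorTable ε ε) 0 0 S₀ (fun i k => (1 / 2) * S₀ i k ^ 2) (fun _ _ => 0) S F →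
        ∀ t ∈ Icc 0 c₀, t ≤ s →
          (∀ s' ∈ Icc 0 t, ∀ i : Fin 2, |S i (kB + 1) s'| ≤ 4 * G ∧ ∀ k : ℤ, k < kL → |S i k s'| ≤ 2 * ℓb) →
            ∀ s' ∈ Icc 0 t, ∀ (i : Fin 2) (k : ℤ), kL ≤ k → k ≤ kB → |S i k s' - Z i k s'| ≤ Dk k)
    (hVt : ∀ s ∈ Icc 0 c₀, |Z 1 kB s| + Dk kB ≤ Vtop)
    (hinit : ∀ z S₀ : Fin 2 → ℤ → ℝ, InTubeWith P Bcl i₀ X₀ w r ζ ustar n z → (∀ i k, w k * |S₀ i k - z i k| ≤ r) →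
      ∀ N : Finset ℤ, (∀ m ∈ N, kB < m) → ∑ m ∈ N, ∑ i : Fin 2, S₀ i m ^ 2 ≤ G ^ 2)
    (hcloseA : 4 / 3 * c₀ * clock ε₀ kB * Vtop * (Vtop + 2 * ε * G) < G)
    (hι : ∀ z S₀ : Fin 2 → ℤ → ℝ, InTubeWith P Bcl i₀ X₀ w r ζ ustar n z → (∀ i k, w k * |S₀ i k - z i k| ≤ r) →
      ∀ (i : Fin 2) (k : ℤ), k < kL → |S₀ i k| ≤ ι)
    (hBLrow : ∀ s ∈ Icc 0 c₀, ∀ i : Fin 2, |Z i kL s| + Dk kL ≤ BL)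
    (hcloseB : ι + c₀ * clockW ε₀ (kL - 1) * tableAbsSum shiftSetFlat (mirrorTable ε ε) * max (2 * ℓb) BL ^ 2 ≤ ℓb)
    (hZb : ∀ (i : Fin 2) (k : ℤ) (s : ℝ), k < kL → Z i k s = 0) (hZa : ∀ (i : Fin 2) (k : ℤ) (s : ℝ), kB < k → Z i k s = 0)
    (hDb : ∀ k : ℤ, k < kL → ℓb ≤ Dk k) (hDa : ∀ k : ℤ, kB < k → 2 * G ≤ Dk k) :
    ∀ z S₀ s S F, InTubeWith P Bcl i₀ X₀ w r ζ ustar n z → (∀ i k, w k * |S₀ i k - z i k| ≤ r) → 0 < s → s ≤ c₀ →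
      PseudoFlowOnShift shiftSetFlat s ε₀ (mirrorTable ε ε) 0 0 S₀ (fun i k => (1 / 2) * S₀ i k ^ 2) (fun _ _ => 0) S F →
        ∀ t ∈ Icc 0 s, ∀ (i : Fin 2) (k : ℤ), |S i k t - Z i k t| ≤ Dk k := by
  intro z S₀ s S F hz hkick hs hsc hflow t ht i k
  have hsubs : Icc 0 s ⊆ Icc 0 c₀ := Icc_subset_Icc le_rfl hsc
  obtain ⟨hIN, hB, hA⟩ := conditionalBlock_closure hflow hε hε₀ hs.le le_rfl hsc hLB hG hℓb hVtop hBL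
    (fun t' ht' => hblock z S₀ s S F hz hkick hs hflow t' (hsubs ht') ht'.2) (fun s' hs' => hVt s' (hsubs hs'))
    (hinit z S₀ hz hkick) hcloseA (hι z S₀ hz hkick) (fun s' hs' => hBLrow s' (hsubs hs')) hcloseB t ht
  rcases lt_or_ge k kL with hk | hk
  · rw [hZb i k t hk, sub_zero]; exact (hB i k hk).trans (hDb k hk)
  rcases le_or_gt k kB with hk' | hk'
  · exact hIN i k hk hk'
  · rw [hZa i k t hk', sub_zero]; exact (hA i k hk').trans (hDa k hk')

end Class

end Summit.NavierStokesRegularity.NavierStokesRegularity.Theorems.HopTube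

end
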